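import Summits.Ventures.YMGap.Thresholds.HaarThirdMomentSU3Trace
import Summits.Ventures.YMGap.Thresholds.HaarSixthMoment
import Summits.Ventures.YMGap.Thresholds.StrongCouplingAnalytic
import Summits.Ventures.YMGap.Thresholds.StrongCouplingAnalyticRadius
import Summits.Ventures.YMGap.Thresholds.StrongCouplingAnalyticPressure
import HarnessLib

/-!
# Venture statement — YMGap (cell `pub-ymgap`) — CONJUNCT BODIES T82 (= T82a,b), T83 (= T83a–f) (V23G, block 1)

STATUS: FILED by p3 g11 as V23G = T82 (= T82a,b) + T83 (= T83a–f) on the chair's ★★ R362 (lead g13, bus 2026-08-25T02:56:00Z, INBOX l.7437 (A), same shape as V23E/V23F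
under ★ R322 (4) / ★ R324 (4) / R347 / R349), quoted: «V23G BOOKING = YES, same shape as V23E∕V23F (R322∕R324∕R347∕R349 pattern): composition T82
`T82_HaarThirdAndSixthMoments` (T82a ∧ T82b) + T83 `T83_StrongCouplingAnalyticCorner` (T83a–f) + any further set that is GREEN-BY-IMPORT and ANNOUNCED on the bus before
your ONE final-sha line (T84+ in your queue order); owner window to 04:00Z (silence = consent); the declared editorial drop of `v1x_ds1g13_block_holds` (a convenience
conjunction, not a T-text, superseded by `T83_…_holds`) is APPROVED as a map entry; referee pre-audit on the candidate bytes; then ONE final-sha line → ONE dry-run → ONE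
`--review` filing → ONE wait (R313; R360 (A) filing truth applies). On ACCEPT it is «in the tree, not of record» exactly like V23E∕V23F; its index entry rides the first
COMBINED append after its olean is built (R349 (A) ∕ R360 (C) unchanged …)». Owner consent: ds-1 g15 named in l.7434 and R362 (A) with a window to 04:00Z 2026-08-25 — no
correction posted (silence = consent); owner lines of record ds-1 g11 l.6154 (block C) and ds-1 g13 l.6570 / END l.6605 («numbering yours»). No further set was announced
GREEN for this block before this line (ds-1 g14 B waits on a closed restatement of its U(1)/ℤ_n text, p3 l.7255; engine-2's every-N texts wait on the owner's pointer,
l.7413), so the composition is exactly T82 + T83; T84+ go to the next block. Referee pre-audit: requested in l.7434 and R362 (A); referee g36's pre-audit legs (mono +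
bytecmp + parents re-hash) are run on this FINAL's bytes before p3's dry-run — its F-line is quoted in p3's SUBMITTED line and in the INDEX-0823 row; this FINAL differs
from the candidate 615a67c696dc7061 in the present STATUS sentence only (decl lines identical). Numbers T82, T83 assigned by p3 under lead g10's delegation (bus
2026-08-24T09:03:51Z «T-numbers (T71+) are p3's to assign»; ★ R322 (4) / ★ R324 (4); lead g12 l.6944 / lead g13 R347 (E): «a set turning GREEN after the V23F final-sha
line goes to V23G») in GREEN order = order of the owners' READY lines, announced on the bus before filing. GREEN = parents are TREE modules with built oleans and the
owner file answers a by-import `lean check` rc 0 / 0 warnings / std axioms: T82 — ds-1 g11 block C `HOME/ds/ds1g11/lean/V1X-CONJUNCTS-ds1g11-C.lean` 1ae61894574c6dca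
(owner line bus l.6154; parents `Thresholds/HaarThirdMomentSU3Trace` p382852 3ee3827d22eb, tree bytes ba29dc04688cd6d3, olean ctime 02:29:15Z 2026-08-25, and
`Thresholds/HaarSixthMoment` p382993 174e9e282e5e, tree bytes 58314232abdf29f4, olean 00:27:30Z) rc 0 at 02:51Z; T83 — ds-1 g13
`HOME/ds/ds1g13/lean/V1X-CONJUNCTS-ds1g13.lean` 8f3eb7908541a266 (owner lines bus l.6570 / END l.6605; parents `Thresholds/StrongCouplingAnalytic` p385616 8563f1886dc2,
tree 8adb23edb81c294f, olean 20:40Z 2026-08-24; `StrongCouplingAnalyticRadius` p385937 e933daf0de83, tree 47d7fce8b271221f, olean 21:37Z; `StrongCouplingAnalyticPressure`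
p386111 04112c055f11, tree 2ffeabcb26985ded, olean ctime 02:33:40Z 2026-08-25) rc 0 at 02:51Z. Only decl names change (map `RENAMES-V23G.txt`: `T_X ↦ T82x_X` / `T83x_X`
with p3's consolidating conjunctions `T82_HaarThirdAndSixthMoments`, `T83_StrongCouplingAnalyticCorner` in the V20B/V22/V23D style, not owner bytes; ONE editorial drop:
the owner's convenience theorem `v1x_ds1g13_block_holds` (a conjunction of 5 of the 6 g13 texts) is omitted — superseded by `T83_StrongCouplingAnalyticCorner_holds` (all
6); it is not a T-text); built mechanically by `mkmono23g.py` (= p2 g11's `mkmono.py`); byte-compare `bytecmp.py --map` = verbatim-modulo-map. NOT IN THIS BLOCK unless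
GREEN before the final-sha line (numbers T84+ are p3's, GREEN order): ds-1 g14 B (`StrongCouplingAllGroupsSharp` built 02:24Z, but its U(1)/ℤ_n text carries instance
binders — p3 l.7255, owner's pen), ds-1 g14 (StrongCouplingAllGroups olean absent), ds-3 g14 part A (KernelClusteringBall), g17 B / C (TorusFreeEnergyRate / …Dim), rb-p2
g10 (ZdAxisMassiveRate), g12 (TransferGapCells), g13 (3 staged parents); parents not yet tree files — ds-1 g11 B / D, g10 C3 / C4, g12, g14 C, ds-3 g14 D–F, g15 H / I /
L, g17 D, ds-4 g11 ×2, g12 b / d, g13 SAW (cells COMPUTATIONAL — not for the index, F-626), rb-p2 g8 (T67a–d / T68a keep the lead's numbers), g9 rest, g11, rb-p1 g7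
`T_O`–`T_S`, g8 `T_U`–`T_AE`, g9 `T_AF`–`T_AI`, engine-2 every-N twisted Poincaré.

HONEST FRAMING. WHAT THIS IS: bodies `Tk_… : Prop` + witnesses `Tk_…_holds`, kernel-checked with NO hypothesis, closing by TREE constants only. (T82) EXACT
COMPACT-GROUP INTEGRALS: `∫_{SU(3)} (tr U)³ = 1`, `∫_{SU(3)} (Re tr U)³ = 1/4` and `∫ (Re tr ρ)³ = 0` for every `SU(N)`, `N ≥ 2`, `N ≠ 3` (only `SU(3)` has a non-zero third
character moment); `∫_{SU(2)} (Re tr U)⁶ = 5` (Catalan `C₃`), `∫ (½ Re tr U)⁶ = 5/64`, `∫ (Re tr U)⁵ = 0` — `β = 0` inputs of the strong-coupling expansion; nothing about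
`β > 0`. (T83) THE REAL-ANALYTIC CORNER, STRONG-COUPLING LATTICE statements (Wilson action): the `SU(2)` `ℤ⁴` free energy density is real-analytic on the explicit
Kotecký–Preiss interval `|β| < (e²·16·257²)⁻¹ ≈ 1.28·10⁻⁷` (tree units) and its Balian–Drouffe–Itzykson Taylor series at `β = 0` CONVERGES to it there; along ANY DLR
selection on the window the expectation of every bounded continuous cylinder observable is real-analytic on `0 < β < 1.28·10⁻⁷`; for EVERY compact metrisable
group, representation and dimension there is a DLR selection (the full-sequence torus limit) with real-analytic expectations on `|β| < plaqRadius ρ d`; the `SU(N)`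
free energy density is real-analytic there for every `N, d`; the `SU(N)` torus partition functions are ZERO-FREE on the disc `‖z‖ ≤ plaqRadius ρ_N d` uniformly in
the volume (a Lee–Yang-type statement at strong coupling); Cauchy bounds `|f⁽ⁿ⁾(0)| ≤ n!·6/r'ⁿ` on the BDI coefficients. The radius is where the Kotecký–Preiss
bound closes — a door artefact (`≈ 10⁻⁷`, far inside the one-state window `[0, 9/50]`), NOT a physical transition, NOT analyticity on the one-state window.
WHAT THIS IS NOT: nothing at the crossover couplings, no continuum limit, no physical-units mass gap, nothing about the Yang–Mills Millennium problem.
-/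

noncomputable section

namespace Summit.Ventures.YMGap

/-! ### OWNER FILE `owners/V1X-CONJUNCTS-ds1g11-C.lean` (sha16 1ae61894574c6dca) — section `V23G_ds1_HaarHigherMoments` -/
section V23G_ds1_HaarHigherMoments

/-!
# v1.x conjunct CANDIDATE texts for p3 (ds-1 g11, block C = parts 14b and 17, both IN THE TREE since 16:46Z / ≈17:00Z; tree-checkable
# once their oleans are built) — NOT a proposal. Each `T_…` is a closed Prop and `T_…_holds` its proof. All HYPOTHESIS-FREE.
HONEST FRAMING: pure compact-group integration (`SU(2)`, `SU(3)`, every `SU(N)`); nothing about `β > 0`, the continuum or Clay.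
-/


open MeasureTheory Set
open Literature.MathematicalPhysics.QuantumLattice
open Literature.MathematicalPhysics.QuantumFieldTheory hiding ZdEdge Site


/-- HAAR-3′ (`SU(3)` and every `SU(N)`): `∫_{SU(3)} (tr U)³ dU = 1`, `∫_{SU(3)} (Re tr U)³ dU = 1/4` (the baryon/determinant vertex in the
character), and for EVERY compact group `G ≅ SU(N)` with `N ≥ 2`, `N ≠ 3`: `∫ (Re tr ρ(g))³ dg = 0` (centre twist) — among all `SU(N)`
only `SU(3)` has a non-zero third character moment. -/
def T82a_SU3HaarThirdMomentDichotomy : Prop :=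
  (∫ U, (U : Matrix (Fin 3) (Fin 3) ℂ).trace ^ 3 ∂haarProbability (Matrix.specialUnitaryGroup (Fin 3) ℂ) = 1) ∧
  (∫ U, ((U : Matrix (Fin 3) (Fin 3) ℂ).trace.re) ^ 3 ∂haarProbability (Matrix.specialUnitaryGroup (Fin 3) ℂ) = 1 / 4) ∧
  ∀ (N : ℕ) (G : Type) [Group G] [TopologicalSpace G] [IsTopologicalGroup G] [CompactSpace G] [MeasurableSpace G]
    [BorelSpace G] (ρ : G →* Matrix (Fin N) (Fin N) ℂ), IsSpecialUnitaryModel ρ → 2 ≤ N → N ≠ 3 →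
    ∫ g, PlaquetteLowerBound.reTr ρ g ^ 3 ∂haarProbability G = 0

/-- Proof of `T82a_SU3HaarThirdMomentDichotomy`. -/
theorem T82a_SU3HaarThirdMomentDichotomy_holds : T82a_SU3HaarThirdMomentDichotomy :=
  ⟨HaarThirdMomentSU3.integral_trace_pow_three_su3, HaarThirdMomentSU3.integral_reTr_pow_three_su3,
    fun _ _ _ _ _ _ _ _ ρ hρ hN hN3 => HaarThirdMomentSU3.integral_reTr_pow_three_eq_zero ρ hρ hN hN3⟩

/-- HAAR-6 (`SU(2)`): `∫_{SU(2)} (Re tr U)⁶ dU = 5` (Catalan `C₃`), `∫_{SU(2)} (½ Re tr U)⁶ dU = 5/64`, `∫_{SU(2)} (Re tr U)⁵ dU = 0` — with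
HAAR-4 (T74a) the even Haar moments of the `SU(2)` character of orders `2, 4, 6` are `1, 2, 5`. -/
def T82b_SU2HaarSixthMoment : Prop :=
  (∫ U, ((U : Matrix (Fin 2) (Fin 2) ℂ).trace.re) ^ 6 ∂haarProbability (Matrix.specialUnitaryGroup (Fin 2) ℂ) = 5) ∧
  (∫ U, ((2 : ℝ)⁻¹ * (U : Matrix (Fin 2) (Fin 2) ℂ).trace.re) ^ 6 ∂haarProbability (Matrix.specialUnitaryGroup (Fin 2) ℂ) = 5 / 64) ∧
  (∫ U, ((U : Matrix (Fin 2) (Fin 2) ℂ).trace.re) ^ 5 ∂haarProbability (Matrix.specialUnitaryGroup (Fin 2) ℂ) = 0)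

/-- Proof of `T82b_SU2HaarSixthMoment`. -/
theorem T82b_SU2HaarSixthMoment_holds : T82b_SU2HaarSixthMoment :=
  ⟨HaarSixthMoment.integral_reTr_pow_six_su2, HaarSixthMoment.integral_half_reTr_pow_six_su2,
    HaarSixthMoment.integral_reTr_pow_five_su2⟩

end V23G_ds1_HaarHigherMoments

/-! ### OWNER FILE `owners/V1X-CONJUNCTS-ds1g13.lean` (sha16 8f3eb7908541a266) — section `V23G_ds1_AnalyticCorner` -/
section V23G_ds1_AnalyticCorner

/-!
# v1.x conjunct CANDIDATE texts for p3 (ds-1 g13, object C-ANALYTIC-0) — NOT a proposal. Numbering is p3's.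
# Each `T_…` is a closed Prop and `T_…_holds` its proof (tree-checkable once the two parents are built; until then green
# inside HOME/ds/ds1g13/lean/MonolithV.lean).
HONEST FRAMING: strong-coupling LATTICE statements (Wilson action): REAL-ANALYTICITY of the free energy density and of the DLR
state in the coupling on a CORNER `|β| < (e²·16·257²)⁻¹ ≈ 1.28·10⁻⁷` (tree units; `SU(2)`, `d = 4`) — the Kotecký–Preiss radius —
NOT on the one-state window `[0, 9/50]`; nothing about the continuum or Clay. All HYPOTHESIS-FREE (the state rows quantify over
DLR selections on the window).
-/


open MeasureTheory Set
open Literature.MathematicalPhysics.QuantumLattice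
open Literature.MathematicalPhysics.QuantumFieldTheory hiding ZdEdge Site
open Literature.MathematicalPhysics.QuantumFieldTheory.Balaban1983to89.Missing (strongCouplingRadius plaqRadius)


/-- C-ANALYTIC-0 (free energy): the `SU(2)` `ℤ⁴` free energy density is REAL-ANALYTIC at every coupling of the explicit
interval `|β| < strongCouplingRadius = (e²·16·257²)⁻¹ ≈ 1.28·10⁻⁷`, and its strong-coupling (Balian–Drouffe–Itzykson) Taylor
series at `β = 0` CONVERGES to it at every such `β`. -/
def T83a_SU2FreeEnergyAnalyticCorner : Prop :=
  ∀ β : ℝ, |β| < strongCouplingRadius (fundamentalRep (Fin 2)) →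
    AnalyticAt ℝ (freeEnergyDensity 4 (fundamentalRep (Fin 2))) β ∧
      HasSum (fun n : ℕ => iteratedDeriv n (freeEnergyDensity 4 (fundamentalRep (Fin 2))) 0 / n.factorial * β ^ n)
        (freeEnergyDensity 4 (fundamentalRep (Fin 2)) β)

/-- Proof of `T83a_SU2FreeEnergyAnalyticCorner`. -/
theorem T83a_SU2FreeEnergyAnalyticCorner_holds : T83a_SU2FreeEnergyAnalyticCorner :=
  fun _ hβ => ⟨StrongCouplingAnalytic.su2_analyticAt_freeEnergyDensity hβ,
    StrongCouplingAnalyticPressure.su2_hasSum_taylor_freeEnergyDensity_dim 4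
      (by rwa [Balaban1983to89.Missing.plaqRadius_four])⟩

/-- C-ANALYTIC-0 (state): along ANY DLR selection on the tree window `[0, 9/50]`, the expectation of EVERY bounded continuous
cylinder observable is REAL-ANALYTIC in the coupling at every `0 < β < strongCouplingRadius ≈ 1.28·10⁻⁷`. -/
def T83b_SU2StateAnalyticCorner : Prop :=
  ∀ (μ : ℝ → Measure (LGConfig 4 (Matrix.specialUnitaryGroup (Fin 2) ℂ))),
    (∀ β ∈ Icc (0 : ℝ) (9 / 50), μ β ∈ ymGibbsMeasures (d := 4) (fundamentalRep (Fin 2)) β) →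
    ∀ (F : LGConfig 4 (Matrix.specialUnitaryGroup (Fin 2) ℂ) → ℝ) (B : Finset (ZdEdge 4)) (C : ℝ),
      IsCylinder F B → Continuous F → (∀ U, |F U| ≤ C) →
      ∀ β : ℝ, 0 < β → β < strongCouplingRadius (fundamentalRep (Fin 2)) →
        AnalyticAt ℝ (fun b => ∫ U, F U ∂(μ b)) β

/-- Proof of `T83b_SU2StateAnalyticCorner`. -/
theorem T83b_SU2StateAnalyticCorner_holds : T83b_SU2StateAnalyticCorner :=
  fun _ hμ _ _ _ hFB hFc hFb _ hβ0 hβ =>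
    StrongCouplingAnalyticRadius.su2_analyticAt_integral_strongCouplingRadius hμ hFB hFc hFb hβ0 hβ

/-- C-ANALYTIC-0 (every gauge group, every dimension): for every `d`, every compact metrisable second-countable group `G` and
every continuous matrix representation `ρ` there is a DLR selection `ν` — the thermodynamic limit of the full sequence of torus
Wilson states — along which the expectation of every bounded continuous cylinder observable is REAL-ANALYTIC in the coupling
on `(-r, r)`, `r = plaqRadius ρ d = (e²·4M_ρ·(16d²+1)²)⁻¹`. -/
def T83c_AnalyticDLRSelectionKP : Prop :=
  ∀ (d N : ℕ) (G : Type) [Group G] [TopologicalSpace G] [IsTopologicalGroup G] [CompactSpace G] [MeasurableSpace G]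
    [BorelSpace G] [SecondCountableTopology G] [T2Space G] (ρ : G →* Matrix (Fin N) (Fin N) ℂ), Continuous ρ →
    ∃ ν : ℝ → Measure (LGConfig d G),
      (∀ β : ℝ, |β| < plaqRadius ρ d → ν β ∈ ymGibbsMeasures ρ β ∧
        Literature.MathematicalPhysics.QuantumLattice.IsInfiniteVolumeLimit ρ β (ν β)) ∧
      ∀ (F : LGConfig d G → ℝ) (B : Finset (ZdEdge d)), IsCylinder F B → Continuous F → (∃ C, ∀ U, |F U| ≤ C) →
        AnalyticOnNhd ℝ (fun β => ∫ U, F U ∂(ν β)) (Ioo (-plaqRadius ρ d) (plaqRadius ρ d))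

/-- Proof of `T83c_AnalyticDLRSelectionKP`. -/
theorem T83c_AnalyticDLRSelectionKP_holds : T83c_AnalyticDLRSelectionKP :=
  fun _ _ _ _ _ _ _ _ _ _ _ ρ hρ => StrongCouplingAnalyticRadius.exists_analytic_dlr_selection_plaqRadius ρ hρ


/-- C-ANALYTIC-0 (free energy, every `N`, every `d`): the free energy density of `SU(N)` lattice Yang–Mills on `ℤ^d` is
REAL-ANALYTIC on the explicit Kotecký–Preiss interval `|β| < plaqRadius ρ_N d = (e²·4M_ρ·(16d²+1)²)⁻¹`. -/
def T83d_SUNFreeEnergyAnalyticKP : Prop :=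
  ∀ d N : ℕ, AnalyticOnNhd ℝ (freeEnergyDensity d (fundamentalRep (Fin N)))
    (Ioo (-plaqRadius (fundamentalRep (Fin N)) d) (plaqRadius (fundamentalRep (Fin N)) d))

/-- Proof of `T83d_SUNFreeEnergyAnalyticKP`. -/
theorem T83d_SUNFreeEnergyAnalyticKP_holds : T83d_SUNFreeEnergyAnalyticKP :=
  fun d N => StrongCouplingAnalyticPressure.analyticOnNhd_freeEnergyDensity_SU_dim d N

/-- C-ANALYTIC-0 (Lee–Yang-type zero-free disc, every `N`, `d`, torus side `L`): the `SU(N)` torus partition function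
`∫ e^{−z S_W} d(⊗ Haar)` has NO complex zeros `z` with `‖z‖ ≤ plaqRadius ρ_N d`, uniformly in the volume. -/
def T83e_SUNTorusPartitionZeroFree : Prop :=
  ∀ (d N L : ℕ) [NeZero L] (z : ℂ), ‖z‖ ≤ plaqRadius (fundamentalRep (Fin N)) d →
    ∫ U : GaugeConfig d L (Matrix.specialUnitaryGroup (Fin N) ℂ),
        Complex.exp (-(z * (wilsonAction (fundamentalRep (Fin N)) U : ℂ)))
      ∂(Measure.pi fun _ : Edge d L => haarProbability (Matrix.specialUnitaryGroup (Fin N) ℂ)) ≠ 0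

/-- Proof of `T83e_SUNTorusPartitionZeroFree`. -/
theorem T83e_SUNTorusPartitionZeroFree_holds : T83e_SUNTorusPartitionZeroFree :=
  fun _ N L _ _ hz => StrongCouplingAnalyticPressure.torus_partition_ne_zero (fundamentalRep (Fin N)) L
    (continuous_fundamentalRep _) hz


/-- C-ANALYTIC-0 (Cauchy bounds on the BDI coefficients, `SU(2)`, `d = 4`): for every `n` and every
`0 < r' < strongCouplingRadius ρ₂ = (e²·16·257²)⁻¹`, `|f⁽ⁿ⁾(0)| ≤ n! · 6 / r'ⁿ` (`6 = #planes of ℤ⁴`). -/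
def T83f_SU2BDICoefficientBound : Prop :=
  ∀ (n : ℕ) (r' : ℝ), 0 < r' → r' < strongCouplingRadius (fundamentalRep (Fin 2)) →
    |iteratedDeriv n (freeEnergyDensity 4 (fundamentalRep (Fin 2))) 0| ≤ n.factorial * 6 / r' ^ n

/-- Proof of `T83f_SU2BDICoefficientBound`. -/
theorem T83f_SU2BDICoefficientBound_holds : T83f_SU2BDICoefficientBound := by
  intro n r' hr' hr'r
  haveI : SecondCountableTopology (Matrix.specialUnitaryGroup (Fin 2) ℂ) :=
    haveI : SecondCountableTopology (Matrix (Fin 2) (Fin 2) ℂ) :=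
      inferInstanceAs (SecondCountableTopology (Fin 2 → Fin 2 → ℂ))
    Topology.IsEmbedding.subtypeVal.secondCountableTopology
  have hcard : (Fintype.card (BoxPair 4) : ℝ) = 6 := by
    rw [show Fintype.card (BoxPair 4) = 6 from by simp [BoxPair, Fintype.card_subtype]; decide]
    norm_num
  have h := StrongCouplingAnalyticPressure.abs_iteratedDeriv_freeEnergyDensity_zero_le (d := 4) (fundamentalRep (Fin 2))
    (continuous_fundamentalRep _) n hr' (by rwa [Balaban1983to89.Missing.plaqRadius_four])
  rwa [hcard] at h



end V23G_ds1_AnalyticCorner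

/-! ### DEFAULT GROUPING (p2): one consolidating conjunction per owner file — `G_<tag> := T_a ∧ T_b ∧ …` + `_holds`.
The lead composes V23G by theme; p3 renames `G_<tag> ↦ T<k>_<Name>` (via --map) or regroups at will; these are additions, not owner bytes. -/
section V23G_groups

/-- Default group for section `V23G_ds1_HaarHigherMoments`: the conjunction of its 2 owner texts. -/
def T82_HaarThirdAndSixthMoments : Prop :=
  T82a_SU3HaarThirdMomentDichotomy ∧ T82b_SU2HaarSixthMoment

/-- `T82_HaarThirdAndSixthMoments` holds (componentwise by the owners' `_holds`). -/
theorem T82_HaarThirdAndSixthMoments_holds : T82_HaarThirdAndSixthMoments :=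
  ⟨T82a_SU3HaarThirdMomentDichotomy_holds, T82b_SU2HaarSixthMoment_holds⟩

/-- Default group for section `V23G_ds1_AnalyticCorner`: the conjunction of its 6 owner texts. -/
def T83_StrongCouplingAnalyticCorner : Prop :=
  T83a_SU2FreeEnergyAnalyticCorner ∧ T83b_SU2StateAnalyticCorner ∧ T83c_AnalyticDLRSelectionKP ∧ T83d_SUNFreeEnergyAnalyticKP ∧ T83e_SUNTorusPartitionZeroFree ∧ T83f_SU2BDICoefficientBound

/-- `T83_StrongCouplingAnalyticCorner` holds (componentwise by the owners' `_holds`). -/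
theorem T83_StrongCouplingAnalyticCorner_holds : T83_StrongCouplingAnalyticCorner :=
  ⟨T83a_SU2FreeEnergyAnalyticCorner_holds, T83b_SU2StateAnalyticCorner_holds, T83c_AnalyticDLRSelectionKP_holds, T83d_SUNFreeEnergyAnalyticKP_holds, T83e_SUNTorusPartitionZeroFree_holds, T83f_SU2BDICoefficientBound_holds⟩

end V23G_groups

end Summit.Ventures.YMGap

end
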